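import Summits.QuantumFields.YangMills.Theorems.LuscherReductionDressedRitzPolyakovLiftEquatorNull
import Summits.QuantumFields.YangMills.Theorems.LuscherReductionDressedRitzPolyakovLiftShadowChart
import Summits.QuantumFields.YangMills.Theorems.LuscherReductionDressedRitzPolyakovLiftShadowPositivity
import HarnessLib

/-!
# Line «polyakovlift» r6 on crux `DressedRitz` (stmt-QuantumFields-20205), W2-F8c: the EQUATOR-REGULARISED shadow observable

Fleet-service module of seat ym-infvol-p1 g7.  The registered one-site shadow of a transplanted observable is `g ∘ powLink L` (`shadowFamily`, p554440/p554989).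
Because the gnomonic chart has a junk value on the equator, `g = transplantFn R f i ∘ rootCoord L μ` jumps across the null set of configurations with an
equatorial link; the everywhere-Lipschitz form of F8c therefore concerns the REGULARISED observables

  `S.indicator g`,  `S = {U : ∀ j, scalarPart (U_j) ≠ 0}`   and   `(S.indicator g) ∘ powLink L = 𝟙{∀ j, scalarPart (U_j^L) ≠ 0} · (g ∘ powLink L)`.

This file (no new definitions — the set is written out):
* `measurableSet_nonEquatorial`; ★ `isPhys_indicator_nonEquatorial` (`S` is gauge- and twist-invariant: `scalarPart_conj`, centre `= {±1}`), ★ `isPhys_regShadow`;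
* `regShadow_apply_of_forall_ne` / `regShadow_apply_of_exists_eq` (values on / off the null set);
* ★★ `regShadow_ae_eq` — `(S.indicator g) ∘ powLink L =ᵐ[configMeasure SU2 1] g ∘ powLink L` (`configMeasure_equatorialPow_null`), hence every `l2`/`qform`/`OpPlat.ins`
  datum of the shadow vector is unchanged (`l2_congr_ae_*`, `qform_congr_ae`, `transferApply_congr_ae` in the tree);
* ★ `linkLipschitz_comp_powLink` — a link-Lipschitz one-site function composed with `powLink L` is link-Lipschitz with the constant multiplied by `L`
  (seat s1 g2's `frobNorm_pow_sub_pow_le`).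

HONEST FRAMING: fixed-lattice bookkeeping for ONE soft-error estimate of ONE one-site stub of a conditional crux on the femto rung R2b1; not infinite volume, not a gap,
not Clay.  References: M. Lüscher, NPB 219 (1983) 233 [cite: Luscher1983, §2–§3]; Bröcker–tom Dieck [cite: BrockerTomDieck1985, I (1.10)].
-/

set_option autoImplicit false

noncomputable section

open MeasureTheory Filter Topology Real Set
open Literature.MathematicalPhysics.QuantumFieldTheory (GaugeConfig Site gaugeTransform frobNorm frobNorm_nonneg)
open Literature.Analysis.OperatorTheory.YMMatrixModel
open Literature.MathematicalPhysics.QuantumLattice (secondCountableTopology_su2)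
open scoped BigOperators Matrix

namespace Summit.QuantumFields.YangMills.Theorems.FemtoTransferGap.PolyakovLift

open Summit.QuantumFields.YangMills.Theorems.FemtoTransferGap

/-! ## §1 The non-equatorial set and the regularised observable -/

/-- The set of one-site configurations without an equatorial link is measurable. [folklore] -/
theorem measurableSet_nonEquatorial : MeasurableSet {U : Cfg | ∀ j : Fin 3, scalarPart (U (edgeOf j)) ≠ 0} := by
  haveI := secondCountableTopology_su2
  have h : {U : Cfg | ∀ j : Fin 3, scalarPart (U (edgeOf j)) ≠ 0} = ⋂ j : Fin 3, {U : Cfg | scalarPart (U (edgeOf j)) ≠ 0} := by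
    ext U; simp
  rw [h]
  refine MeasurableSet.iInter fun j => ?_
  exact (measurableSet_eq_fun (continuous_scalarPart.comp (continuous_apply (edgeOf j))).measurable measurable_const).compl

/-- The non-equatorial set is invariant under simultaneous conjugation (gauge transformations at one site). [folklore] -/
theorem mem_nonEquatorial_gaugeTransform (h : Site 3 1 → SU2) (U : Cfg) :
    (gaugeTransform h U ∈ {U : Cfg | ∀ j : Fin 3, scalarPart (U (edgeOf j)) ≠ 0}) ↔ U ∈ {U : Cfg | ∀ j : Fin 3, scalarPart (U (edgeOf j)) ≠ 0} := by
  simp only [mem_setOf_eq, gaugeTransform_one_site_eq, scalarPart_conj]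

/-- The non-equatorial set is invariant under central twists (`z = ±1`, `scalarPart (−W) = −scalarPart W`). [folklore] -/
theorem mem_nonEquatorial_twist (k : Fin 3) {z : SU2} (hz : z ∈ Subgroup.center SU2) (U : Cfg) :
    (twist k z U ∈ {U : Cfg | ∀ j : Fin 3, scalarPart (U (edgeOf j)) ≠ 0}) ↔ U ∈ {U : Cfg | ∀ j : Fin 3, scalarPart (U (edgeOf j)) ≠ 0} := by
  simp only [mem_setOf_eq, twist_one_site]
  rcases eq_one_or_eq_negOne_of_mem_center hz with rfl | rfl
  · simp
  · refine forall_congr' fun j => ?_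
    by_cases hj : (edgeOf j).2 = k
    · rw [if_pos hj, scalarPart_negOne_mul, neg_ne_zero]
    · rw [if_neg hj]

/-- ★ **The regularised observable is physical**: for physical `g`, `S.indicator g` (`S` = no equatorial link) is measurable, bounded, gauge- and twist-invariant. [cite: Luscher1983, §2–§3] -/
theorem isPhys_indicator_nonEquatorial {g : Cfg → ℝ} (hg : IsPhys g) :
    IsPhys ({U : Cfg | ∀ j : Fin 3, scalarPart (U (edgeOf j)) ≠ 0}.indicator g) where
  measurable := hg.measurable.indicator measurableSet_nonEquatorial
  bounded := by
    obtain ⟨C, hC⟩ := hg.bounded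
    refine ⟨C, fun U => ?_⟩
    by_cases hU : U ∈ {U : Cfg | ∀ j : Fin 3, scalarPart (U (edgeOf j)) ≠ 0}
    · rw [indicator_of_mem hU]; exact hC U
    · rw [indicator_of_notMem hU, abs_zero]; exact (abs_nonneg _).trans (hC U)
  gaugeInv := fun h U => by
    by_cases hU : U ∈ {U : Cfg | ∀ j : Fin 3, scalarPart (U (edgeOf j)) ≠ 0}
    · rw [indicator_of_mem hU, indicator_of_mem ((mem_nonEquatorial_gaugeTransform h U).2 hU), hg.gaugeInv]
    · rw [indicator_of_notMem hU, indicator_of_notMem (fun h' => hU ((mem_nonEquatorial_gaugeTransform h U).1 h'))]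
  zeroFlux := fun k z hz U => by
    by_cases hU : U ∈ {U : Cfg | ∀ j : Fin 3, scalarPart (U (edgeOf j)) ≠ 0}
    · rw [indicator_of_mem hU, indicator_of_mem ((mem_nonEquatorial_twist k hz U).2 hU), hg.zeroFlux k z hz]
    · rw [indicator_of_notMem hU, indicator_of_notMem (fun h' => hU ((mem_nonEquatorial_twist k hz U).1 h'))]

/-- ★ **The regularised shadow observable is physical**: `(S.indicator g) ∘ powLink L`. [cite: Luscher1983, §3] -/
theorem isPhys_regShadow (L : ℕ) {g : Cfg → ℝ} (hg : IsPhys g) :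
    IsPhys (fun U : Cfg => {U : Cfg | ∀ j : Fin 3, scalarPart (U (edgeOf j)) ≠ 0}.indicator g (powLink L U)) :=
  isPhys_comp_powLink L (isPhys_indicator_nonEquatorial hg)

/-- On configurations none of whose `L`-th powers is equatorial the regularised shadow is the shadow. [folklore] -/
theorem regShadow_apply_of_forall_ne (L : ℕ) (g : Cfg → ℝ) {U : Cfg} (hU : ∀ j : Fin 3, scalarPart ((U (edgeOf j)) ^ L) ≠ 0) :
    {U : Cfg | ∀ j : Fin 3, scalarPart (U (edgeOf j)) ≠ 0}.indicator g (powLink L U) = g (powLink L U) :=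
  indicator_of_mem (by simpa [powLink_apply] using hU) g

/-- On the null set it vanishes. [folklore] -/
theorem regShadow_apply_of_exists_eq (L : ℕ) (g : Cfg → ℝ) {U : Cfg} (hU : ∃ j : Fin 3, scalarPart ((U (edgeOf j)) ^ L) = 0) :
    {U : Cfg | ∀ j : Fin 3, scalarPart (U (edgeOf j)) ≠ 0}.indicator g (powLink L U) = 0 := by
  refine indicator_of_notMem (fun h => ?_) g
  obtain ⟨j, hj⟩ := hU
  exact h j (by simpa [powLink_apply] using hj)

/-- ★★ **The regularisation is invisible almost everywhere**: `(S.indicator g) ∘ powLink L = g ∘ powLink L` `configMeasure`-a.e. (the exceptional set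
`{∃ j, scalarPart (U_j^L) = 0}` is null, `configMeasure_equatorialPow_null`). [cite: BrockerTomDieck1985, IV (2.2)] -/
theorem regShadow_ae_eq (L : ℕ) (g : Cfg → ℝ) :
    (fun U : Cfg => {U : Cfg | ∀ j : Fin 3, scalarPart (U (edgeOf j)) ≠ 0}.indicator g (powLink L U)) =ᵐ[configMeasure SU2 1]
      fun U : Cfg => g (powLink L U) := by
  have hnull := configMeasure_equatorialPow_null L
  rw [Filter.EventuallyEq, ae_iff]
  refine measure_mono_null (fun U hU => ?_) hnull
  by_contra hcon
  simp only [mem_setOf_eq, not_exists] at hcon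
  exact hU (regShadow_apply_of_forall_ne L g hcon)

/-! ## §2 Link-Lipschitz functions and the power map -/

/-- ★ **Composition with the power map multiplies a link-Lipschitz constant by `L`** (`‖U^L − V^L‖_F ≤ L‖U − V‖_F`, seat s1's `frobNorm_pow_sub_pow_le`).
[cite: Luscher1983, §3] -/
theorem linkLipschitz_comp_powLink (L : ℕ) {h : Cfg → ℝ} {Λ : ℝ} (hΛ : 0 ≤ Λ)
    (hLip : ∀ U V : Cfg, |h U - h V| ≤ Λ * ∑ e, frobNorm ((U e : Matrix (Fin 2) (Fin 2) ℂ) - (V e : Matrix (Fin 2) (Fin 2) ℂ))) (U V : Cfg) :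
    |h (powLink L U) - h (powLink L V)| ≤ (Λ * L) * ∑ e, frobNorm ((U e : Matrix (Fin 2) (Fin 2) ℂ) - (V e : Matrix (Fin 2) (Fin 2) ℂ)) := by
  refine (hLip (powLink L U) (powLink L V)).trans ?_
  have hsum : ∑ e, frobNorm ((powLink L U e : Matrix (Fin 2) (Fin 2) ℂ) - (powLink L V e : Matrix (Fin 2) (Fin 2) ℂ)) ≤
      ∑ e, (L : ℝ) * frobNorm ((U e : Matrix (Fin 2) (Fin 2) ℂ) - (V e : Matrix (Fin 2) (Fin 2) ℂ)) :=
    Finset.sum_le_sum fun e _ => by simp only [powLink_apply]; exact frobNorm_pow_sub_pow_le (U e) (V e) L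
  calc Λ * ∑ e, frobNorm ((powLink L U e : Matrix (Fin 2) (Fin 2) ℂ) - (powLink L V e : Matrix (Fin 2) (Fin 2) ℂ))
      ≤ Λ * ∑ e, (L : ℝ) * frobNorm ((U e : Matrix (Fin 2) (Fin 2) ℂ) - (V e : Matrix (Fin 2) (Fin 2) ℂ)) := mul_le_mul_of_nonneg_left hsum hΛ
    _ = (Λ * L) * ∑ e, frobNorm ((U e : Matrix (Fin 2) (Fin 2) ℂ) - (V e : Matrix (Fin 2) (Fin 2) ℂ)) := by rw [← Finset.mul_sum]; ring

end Summit.QuantumFields.YangMills.Theorems.FemtoTransferGap.PolyakovLift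

end
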